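import Summits.CriticalPhenomena.PercolationContinuityZ3.Theorems.Transplant.SkelSignCustomersAll
import HarnessLib

/-!
# A Cayley graph of the `b₁ = 1` group `(ℤ² ⋊ C₄) × ℤ` with `θ(p_c) = 0`, UNCONDITIONALLY: `X □ ℤ` for `X = Cay(ℤ² ⋊ C₄; ρ, x)` —
# the ROTOR SQUARE LATTICE `X` carries a four-type one-dimensional reflectable skeleton (side-on customer of the closed D″ node)

builds on p205010 (kernel theorem, internal audit signed; external expert review pending): the unconditional theorem of this file runs through
`LineSkeletonNeg.prodInt_criticalContinuity_holds` (closed multi-type D″ node, near-one gluing), which builds on p205010.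
Lane `prim-bschramm`, seat `prim-bschramm-p4` (gen 19; PART C3, `HOME/bschramm/P4-GENERAL.md` §41.4).  Helper file
(`--supports stmt-CriticalPhenomena-4575 --as helper`).

WHY.  The virtually-`ℤ³` group `Γ = (ℤ² ⋊ C₄) × ℤ` (`ρ` = rotation by a quarter turn) has `b₁(Γ) = 1` and sits on the multi-type wall (d′) of the C3 class map
(P4-GENERAL §38.6/§39.4: no transitive chart-translating group; with a TALL alphabet its Cayley graph needs the forbidden multi-type node).  The wall is
a property of the pair (graph, interface), not of the group: for the alphabet `{ρ^{±1}, x^{±1}, t^{±1}}` the Cayley graph is `X □ ℤ` with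
`X = Cay(ℤ² ⋊ C₄; ρ^{±1}, x^{±1})` — the ROTOR SQUARE LATTICE: vertices `(v, k) ∈ ℤ² × ℤ/4` (position, heading), bonds `(v,k) ∼ (v ± ρ^k e₀, k)` (move
along the heading) and `(v,k) ∼ (v, k ± 1)` (turn).  `X` carries a `LineSkeletonNeg` with FOUR base types: height `ψ(v,k) = v₀ + v₁` (a move changes it
by `±1` whatever the heading, a turn by `0`), frames = the translations `v ↦ v + u` (automorphisms = left multiplications by `ℤ²`), the reflection at each
base vertex `(0,k)` = `v ↦ −v` (the `S`-preserving automorphism `(v,σ) ↦ (−v,σ)` of `ℤ² ⋊ C₄`), connected strips `{|v₀+v₁| ≤ ℓ}`, `ℓ ≥ 1`.  Hence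
(`LineSkeletonNeg.prodInt_criticalContinuity_holds`, gen 8's side-on theorem + gen 15's Φ2):
**`Z2Rot.criticalContinuity : ∀ v, θ_v(p_c(X □ ℤ)) = 0` — unconditional.**  (The identification `X □ ℤ = Cay((ℤ²⋊C₄)×ℤ; ρ, x, t)` is the definition
of the Cayley graph of a semidirect product read in coordinates; it is stated, not typed, here.)
[cite: BenjaminiSchramm1996, Conj. 4; §2 (Cayley graphs)] [cite: KozmaNitzan2024, §4 p. 16 (Lemma 8: the lattice symmetries)]
-/

noncomputable section

namespace Summit.CriticalPhenomena.PercolationContinuityZ3.Theorems.Transplant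

open MeasureTheory Literature.Probability.Percolation Literature.Probability.LatticeModels SimpleGraph
open scoped Classical

namespace Z2Rot

/-! ## §1 The rotor square lattice `X = Cay(ℤ² ⋊ C₄; ρ, x)` -/

/-- The heading vectors `ρ^k e₀`: `e₀, e₁, −e₀, −e₁`. [folklore] -/
def dir : Fin 4 → Site 2 := ![Pi.single 0 1, Pi.single 1 1, -Pi.single 0 1, -Pi.single 1 1]

/-- The height change of a move with heading `k`: `+1, +1, −1, −1`. [folklore] -/
def sdir : Fin 4 → ℤ := ![1, 1, -1, -1]

/-- `dir k 0 + dir k 1 = sdir k`. [folklore] -/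
theorem dir_sum (k : Fin 4) : dir k 0 + dir k 1 = sdir k := by
  fin_cases k <;> simp [dir, sdir]

/-- `dir k ≠ 0`. [folklore] -/
theorem dir_ne_zero (k : Fin 4) : dir k ≠ 0 := by
  intro h
  have h0 := congrFun h 0
  have h1 := congrFun h 1
  fin_cases k <;> simp [dir] at h0 h1

/-- The vertices: position and heading. [folklore] -/
abbrev Vtx : Type := Site 2 × Fin 4

/-- **The rotor square lattice** `X = Cay(ℤ² ⋊ C₄; ρ^{±1}, x^{±1})`: generating relation = a move along the heading, or a left turn.
[cite: BenjaminiSchramm1996, §2 (Cayley graphs)] -/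
def graph : SimpleGraph Vtx :=
  SimpleGraph.fromRel fun a b => (b.2 = a.2 ∧ b.1 = a.1 + dir a.2) ∨ (b.1 = a.1 ∧ b.2 = a.2 + 1)

/-- Adjacency unfolded. [folklore] -/
theorem adj_iff (a b : Vtx) : graph.Adj a b ↔ a ≠ b ∧
    (((b.2 = a.2 ∧ b.1 = a.1 + dir a.2) ∨ (b.1 = a.1 ∧ b.2 = a.2 + 1)) ∨ ((a.2 = b.2 ∧ a.1 = b.1 + dir b.2) ∨ (a.1 = b.1 ∧ a.2 = b.2 + 1))) :=
  SimpleGraph.fromRel_adj _ _ _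

/-- A move along the heading is a bond. [folklore] -/
theorem adj_move (v : Site 2) (k : Fin 4) : graph.Adj (v, k) (v + dir k, k) := by
  refine (adj_iff _ _).2 ⟨fun h => dir_ne_zero k ?_, Or.inl (Or.inl ⟨rfl, rfl⟩)⟩
  have := congrArg Prod.fst h
  simpa using this.symm

/-- A move against the heading is a bond. [folklore] -/
theorem adj_move' (v : Site 2) (k : Fin 4) : graph.Adj (v, k) (v - dir k, k) := by
  have := (adj_move (v - dir k) k).symm
  rwa [sub_add_cancel] at this

/-- A left turn is a bond. [folklore] -/
theorem adj_turn (v : Site 2) (k : Fin 4) : graph.Adj (v, k) (v, k + 1) := by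
  refine (adj_iff _ _).2 ⟨fun h => ?_, Or.inl (Or.inr ⟨rfl, rfl⟩)⟩
  have h2 : k = k + 1 := by simpa using congrArg Prod.snd h
  revert h2
  fin_cases k <;> decide

/-- A right turn is a bond. [folklore] -/
theorem adj_turn' (v : Site 2) (k : Fin 4) : graph.Adj (v, k) (v, k - 1) := by
  have := (adj_turn v (k - 1)).symm
  rwa [sub_add_cancel] at this

/-- The four candidates for a neighbour. [folklore] -/
def nbrs (a : Vtx) : Finset Vtx := {(a.1 + dir a.2, a.2), (a.1 - dir a.2, a.2), (a.1, a.2 + 1), (a.1, a.2 - 1)}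

/-- Every neighbour is one of the four candidates. [folklore] -/
theorem mem_nbrs_of_adj {a b : Vtx} (h : graph.Adj a b) : b ∈ nbrs a := by
  obtain ⟨-, h | h⟩ := (adj_iff a b).1 h
  · rcases h with ⟨h2, h1⟩ | ⟨h1, h2⟩
    · have : b = (a.1 + dir a.2, a.2) := Prod.ext h1 h2
      simp [nbrs, this]
    · have : b = (a.1, a.2 + 1) := Prod.ext h1 h2
      simp [nbrs, this]
  · rcases h with ⟨h2, h1⟩ | ⟨h1, h2⟩
    · have : b = (a.1 - dir a.2, a.2) := by
        refine Prod.ext ?_ h2.symm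
        show b.1 = a.1 - dir a.2
        rw [h1, h2, add_sub_cancel_right]
      simp [nbrs, this]
    · have : b = (a.1, a.2 - 1) := by
        refine Prod.ext h1.symm ?_
        show b.2 = a.2 - 1
        rw [h2, add_sub_cancel_right]
      simp [nbrs, this]

/-- The neighbour set lies in the candidate set. [folklore] -/
theorem neighborSet_subset (a : Vtx) : graph.neighborSet a ⊆ ↑(nbrs a) := fun _ hb => mem_nbrs_of_adj hb

/-- `X` is locally finite. [folklore] -/
instance graph_locallyFinite : graph.LocallyFinite := fun a => ((Finset.finite_toSet _).subset (neighborSet_subset a)).fintype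

/-- Every vertex has degree `≤ 4`. [folklore] -/
theorem degree_le (a : Vtx) : graph.degree a ≤ 4 := by
  rw [← card_neighborFinset_eq_degree]
  have hsub : graph.neighborFinset a ⊆ nbrs a := fun b hb => mem_nbrs_of_adj ((mem_neighborFinset _ _ _).1 hb)
  refine (Finset.card_le_card hsub).trans ?_
  unfold nbrs
  refine (Finset.card_insert_le _ _).trans ?_
  refine (Nat.succ_le_succ (Finset.card_insert_le _ _)).trans ?_
  refine (Nat.succ_le_succ (Nat.succ_le_succ (Finset.card_insert_le _ _))).trans ?_
  rw [Finset.card_singleton]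

/-! ## §2 Automorphisms: translations and the central inversion of the position -/

/-- Translating the position preserves adjacency. [folklore] -/
theorem adj_shift {a b : Vtx} (u : Site 2) (h : graph.Adj a b) : graph.Adj (a.1 + u, a.2) (b.1 + u, b.2) := by
  have hb := mem_nbrs_of_adj h
  simp only [nbrs, Finset.mem_insert, Finset.mem_singleton] at hb
  rcases hb with rfl | rfl | rfl | rfl
  · have e : (a.1 + dir a.2 + u, a.2) = (a.1 + u + dir a.2, a.2) := by rw [add_right_comm]
    rw [e]; exact adj_move _ _
  · have e : (a.1 - dir a.2 + u, a.2) = (a.1 + u - dir a.2, a.2) := by rw [sub_add_eq_add_sub]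
    rw [e]; exact adj_move' _ _
  · exact adj_turn _ _
  · exact adj_turn' _ _

/-- **Translation of the position** `(w, m) ↦ (w + u, m)` (left multiplication by `u ∈ ℤ²`). [cite: BenjaminiSchramm1996, §2] -/
def shiftIso (u : Site 2) : graph ≃g graph where
  toEquiv := Equiv.prodCongr (Equiv.addRight u) (Equiv.refl _)
  map_rel_iff' := by
    intro a b
    show graph.Adj (a.1 + u, a.2) (b.1 + u, b.2) ↔ graph.Adj a b
    refine ⟨fun h => ?_, adj_shift u⟩
    have := adj_shift (-u) h
    simpa using this

/-- **Inversion of the position** `(w, m) ↦ (−w, m)` (the `S`-preserving group automorphism `(v,σ) ↦ (−v,σ)`). [cite: KozmaNitzan2024, §4 Lemma 8] -/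
def negIso : graph ≃g graph where
  toEquiv := Equiv.prodCongr (Equiv.neg (Site 2)) (Equiv.refl _)
  map_rel_iff' := by
    intro a b
    show graph.Adj (-a.1, a.2) (-b.1, b.2) ↔ graph.Adj a b
    have key : ∀ a b : Vtx, graph.Adj a b → graph.Adj (-a.1, a.2) (-b.1, b.2) := by
      intro a b h
      obtain ⟨hne, h | h⟩ := (adj_iff a b).1 h
      · rcases h with ⟨h2, h1⟩ | ⟨h1, h2⟩
        · -- `b = a + dir`: then `−a = −b + dir a.2`, a move from `−b` (same heading)
          have e : (-a.1, a.2) = (-b.1 + dir b.2, b.2) := by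
            refine Prod.ext ?_ h2.symm
            show -a.1 = -b.1 + dir b.2
            rw [h1, h2]; abel
          rw [e]
          exact (adj_move (-b.1) b.2).symm
        · have e : (-b.1, b.2) = (-a.1, a.2 + 1) := Prod.ext (by show -b.1 = -a.1; rw [h1]) h2
          rw [e]
          exact adj_turn (-a.1) a.2
      · rcases h with ⟨h2, h1⟩ | ⟨h1, h2⟩
        · have e : (-b.1, b.2) = (-a.1 + dir a.2, a.2) := by
            refine Prod.ext ?_ h2.symm
            show -b.1 = -a.1 + dir a.2
            rw [h1, h2]; abel
          rw [e]
          exact adj_move (-a.1) a.2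
        · have e : (-a.1, a.2) = (-b.1, b.2 + 1) := Prod.ext (by show -a.1 = -b.1; rw [h1]) h2
          rw [e]
          exact (adj_turn (-b.1) b.2).symm
    refine ⟨fun h => ?_, key a b⟩
    have := key _ _ h
    simpa using this

/-! ## §3 The height `ψ = v₀ + v₁`, its strips, and their connectedness -/

/-- The height `ψ(v, k) = v₀ + v₁`. [folklore] -/
def ψ (a : Vtx) : ℤ := a.1 0 + a.1 1

/-- `ψ` unfolded. [folklore] -/
@[simp] theorem ψ_mk (v : Site 2) (k : Fin 4) : ψ (v, k) = v 0 + v 1 := rfl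

/-- A move changes the height by `sdir k = ±1`. [folklore] -/
theorem ψ_move (v : Site 2) (k : Fin 4) : ψ (v + dir k, k) = ψ (v, k) + sdir k := by
  simp only [ψ_mk, Pi.add_apply, ← dir_sum]; ring

/-- Along a bond the height changes by at most one. [folklore] -/
theorem abs_ψ_sub_le {a b : Vtx} (h : graph.Adj a b) : |ψ a - ψ b| ≤ 1 := by
  have hb := mem_nbrs_of_adj h
  simp only [nbrs, Finset.mem_insert, Finset.mem_singleton] at hb
  obtain ⟨v, k⟩ := a
  rcases hb with rfl | rfl | rfl | rfl
  · rw [ψ_move]; fin_cases k <;> simp [sdir]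
  · have := ψ_move (v - dir k) k
    rw [sub_add_cancel] at this
    rw [this]; fin_cases k <;> simp [sdir]
  · simp
  · simp

/-- The strip of half-width `ℓ` around height `0`. [folklore] -/
abbrev stripSet (ℓ : ℕ) : Set Vtx := {w | |ψ w - ψ (((0 : Site 2), (0 : Fin 4)) : Vtx)| ≤ ℓ}

/-- Membership in the strip. [folklore] -/
theorem mem_stripSet {ℓ : ℕ} {w : Vtx} : w ∈ stripSet ℓ ↔ |ψ w| ≤ ℓ := by simp [stripSet, ψ]

/-- One induced step. [folklore] -/
theorem stripAdj {ℓ : ℕ} {u v : Vtx} (hu : u ∈ stripSet ℓ) (hv : v ∈ stripSet ℓ) (h : graph.Adj u v) :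
    (graph.induce (stripSet ℓ)).Adj ⟨u, hu⟩ ⟨v, hv⟩ := h

/-- Turning keeps the strip: `(v, k)` is joined to `(v, 0)` inside every strip containing it. [folklore] -/
theorem reachable_turn {ℓ : ℕ} (v : Site 2) (k : Fin 4) (h : ((v, k) : Vtx) ∈ stripSet ℓ) :
    (graph.induce (stripSet ℓ)).Reachable ⟨(v, k), h⟩ ⟨(v, 0), by rw [mem_stripSet] at h ⊢; simpa using h⟩ := by
  have hm : ∀ m : Fin 4, ((v, m) : Vtx) ∈ stripSet ℓ := fun m => by rw [mem_stripSet] at h ⊢; simpa using h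
  have st : ∀ m : Fin 4, (graph.induce (stripSet ℓ)).Reachable ⟨(v, m), hm m⟩ ⟨(v, m - 1), hm (m - 1)⟩ :=
    fun m => (stripAdj (hm m) (hm (m - 1)) (adj_turn' v m)).reachable
  fin_cases k
  · rfl
  · exact st 1
  · exact (st 2).trans (st 1)
  · exact ((st 3).trans (st 2)).trans (st 1)

/-- A move `v ↦ v + e₀` at heading `0` inside the strip. [folklore] -/
theorem reachable_e0 {ℓ : ℕ} (v : Site 2) (h : ((v, (0 : Fin 4)) : Vtx) ∈ stripSet ℓ) (h' : ((v + dir 0, (0 : Fin 4)) : Vtx) ∈ stripSet ℓ) :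
    (graph.induce (stripSet ℓ)).Reachable ⟨(v, 0), h⟩ ⟨(v + dir 0, 0), h'⟩ := (stripAdj h h' (adj_move v 0)).reachable

/-- A move `v ↦ v + e₁` via heading `1` inside the strip: turn, move, turn back. [folklore] -/
theorem reachable_e1 {ℓ : ℕ} (v : Site 2) (h : ((v, (0 : Fin 4)) : Vtx) ∈ stripSet ℓ) (h' : ((v + dir 1, (0 : Fin 4)) : Vtx) ∈ stripSet ℓ) :
    (graph.induce (stripSet ℓ)).Reachable ⟨(v, 0), h⟩ ⟨(v + dir 1, 0), h'⟩ := by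
  have h1 : ((v, (1 : Fin 4)) : Vtx) ∈ stripSet ℓ := by rw [mem_stripSet] at h ⊢; simpa using h
  have h1' : ((v + dir 1, (1 : Fin 4)) : Vtx) ∈ stripSet ℓ := by rw [mem_stripSet] at h' ⊢; simpa using h'
  exact (((stripAdj h h1 (adj_turn v 0)).reachable.trans (stripAdj h1 h1' (adj_move v 1)).reachable).trans
    (reachable_turn (v + dir 1) 1 h1'))

/-- The reverse `e₀` move inside the strip. [folklore] -/
theorem reachable_e0' {ℓ : ℕ} (v : Site 2) (h : ((v, (0 : Fin 4)) : Vtx) ∈ stripSet ℓ) (h' : ((v - dir 0, (0 : Fin 4)) : Vtx) ∈ stripSet ℓ) :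
    (graph.induce (stripSet ℓ)).Reachable ⟨(v, 0), h⟩ ⟨(v - dir 0, 0), h'⟩ := by
  have := reachable_e0 (v - dir 0) h' (by rw [sub_add_cancel]; exact h)
  have e : (⟨(v - dir 0 + dir 0, 0), by rw [sub_add_cancel]; exact h⟩ : stripSet ℓ) = ⟨(v, 0), h⟩ :=
    Subtype.ext (show ((v - dir 0 + dir 0, (0 : Fin 4)) : Vtx) = (v, 0) by rw [sub_add_cancel])
  rw [e] at this
  exact this.symm

/-- The reverse `e₁` move inside the strip. [folklore] -/
theorem reachable_e1' {ℓ : ℕ} (v : Site 2) (h : ((v, (0 : Fin 4)) : Vtx) ∈ stripSet ℓ) (h' : ((v - dir 1, (0 : Fin 4)) : Vtx) ∈ stripSet ℓ) :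
    (graph.induce (stripSet ℓ)).Reachable ⟨(v, 0), h⟩ ⟨(v - dir 1, 0), h'⟩ := by
  have := reachable_e1 (v - dir 1) h' (by rw [sub_add_cancel]; exact h)
  have e : (⟨(v - dir 1 + dir 1, 0), by rw [sub_add_cancel]; exact h⟩ : stripSet ℓ) = ⟨(v, 0), h⟩ :=
    Subtype.ext (show ((v - dir 1 + dir 1, (0 : Fin 4)) : Vtx) = (v, 0) by rw [sub_add_cancel])
  rw [e] at this
  exact this.symm

/-- Coordinates after the four unit moves. [folklore] -/
theorem coords_move (v : Site 2) :
    ((v + dir 0) 0 = v 0 + 1 ∧ (v + dir 0) 1 = v 1) ∧ ((v - dir 0) 0 = v 0 - 1 ∧ (v - dir 0) 1 = v 1) ∧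
      ((v + dir 1) 0 = v 0 ∧ (v + dir 1) 1 = v 1 + 1) ∧ ((v - dir 1) 0 = v 0 ∧ (v - dir 1) 1 = v 1 - 1) := by
  simp [dir]

/-- **Every vertex of the strip is joined to `((0,0), 0)` inside the strip** (`ℓ ≥ 1`): turn to heading `0`, then reduce `|v₀| + |v₁|` by unit moves
`±e₀` (heading `0`) and `±e₁` (via heading `1`), choosing at each step a move that keeps the height in `[−ℓ, ℓ]`. [folklore] -/
theorem reachable_zero {ℓ : ℕ} (hℓ : 1 ≤ ℓ) (w : Vtx) (hw : w ∈ stripSet ℓ) :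
    (graph.induce (stripSet ℓ)).Reachable ⟨w, hw⟩ ⟨((0 : Site 2), 0), by rw [mem_stripSet]; simp⟩ := by
  obtain ⟨v, k⟩ := w
  refine (reachable_turn v k hw).trans ?_
  have hv0 : ((v, (0 : Fin 4)) : Vtx) ∈ stripSet ℓ := by rw [mem_stripSet] at hw ⊢; simpa using hw
  suffices H : ∀ n : ℕ, ∀ (v : Site 2) (hv : ((v, (0 : Fin 4)) : Vtx) ∈ stripSet ℓ), (v 0).natAbs + (v 1).natAbs = n →
      (graph.induce (stripSet ℓ)).Reachable ⟨(v, 0), hv⟩ ⟨((0 : Site 2), 0), by rw [mem_stripSet]; simp⟩ from H _ v hv0 rfl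
  have hℓ' : (1 : ℤ) ≤ ℓ := by exact_mod_cast hℓ
  intro n
  induction n using Nat.strong_induction_on with
  | _ n ih =>
    intro v hv hn
    have hψ : |v 0 + v 1| ≤ ℓ := by have := mem_stripSet.1 hv; simpa using this
    rw [abs_le] at hψ
    obtain ⟨⟨c00, c01⟩, ⟨c10, c11⟩, ⟨c20, c21⟩, ⟨c30, c31⟩⟩ := coords_move v
    by_cases h00 : v 0 = 0 ∧ v 1 = 0
    · have : v = 0 := by funext j; fin_cases j <;> simp [h00.1, h00.2]
      subst this; rfl
    -- pick a move: towards 0 in one coordinate, keeping the height inside the strip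
    by_cases hA : v 0 < 0 ∧ v 0 + v 1 + 1 ≤ ℓ
    · -- move +e₀
      have hm : ((v + dir 0, (0 : Fin 4)) : Vtx) ∈ stripSet ℓ := by rw [mem_stripSet, ψ_mk, c00, c01, abs_le]; omega
      exact (reachable_e0 v hv hm).trans (ih _ (by rw [← hn, c00, c01]; omega) _ hm rfl)
    by_cases hB : 0 < v 0 ∧ -(ℓ : ℤ) ≤ v 0 + v 1 - 1
    · -- move −e₀
      have hm : ((v - dir 0, (0 : Fin 4)) : Vtx) ∈ stripSet ℓ := by rw [mem_stripSet, ψ_mk, c10, c11, abs_le]; omega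
      exact (reachable_e0' v hv hm).trans (ih _ (by rw [← hn, c10, c11]; omega) _ hm rfl)
    by_cases hC : v 1 < 0 ∧ v 0 + v 1 + 1 ≤ ℓ
    · -- move +e₁
      have hm : ((v + dir 1, (0 : Fin 4)) : Vtx) ∈ stripSet ℓ := by rw [mem_stripSet, ψ_mk, c20, c21, abs_le]; omega
      exact (reachable_e1 v hv hm).trans (ih _ (by rw [← hn, c20, c21]; omega) _ hm rfl)
    · -- move −e₁ (the remaining case: v 1 > 0 and the height allows going down)
      have hD : 0 < v 1 ∧ -(ℓ : ℤ) ≤ v 0 + v 1 - 1 := by omega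
      have hm : ((v - dir 1, (0 : Fin 4)) : Vtx) ∈ stripSet ℓ := by rw [mem_stripSet, ψ_mk, c30, c31, abs_le]; omega
      exact (reachable_e1' v hv hm).trans (ih _ (by rw [← hn, c30, c31]; omega) _ hm rfl)

/-! ## §4 The one-dimensional reflectable skeleton (four types) and the unconditional theorem -/

/-- The four base vertices `((0,0), k)`. [folklore] -/
def types : Finset Vtx := {((0 : Site 2), (0 : Fin 4)), ((0 : Site 2), 1), ((0 : Site 2), 2), ((0 : Site 2), 3)}

/-- `((0,0), k)` is a base vertex. [folklore] -/
theorem mem_types (k : Fin 4) : (((0 : Site 2), k) : Vtx) ∈ types := by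
  fin_cases k <;> simp [types]

/-- **THE ROTOR SQUARE LATTICE CARRIES A `LineSkeletonNeg` WITH FOUR TYPES**: height `v₀ + v₁`, frames = translations, reflection = `v ↦ −v` at each
`((0,0), k)`, degree `≤ 4`, unit steps along the heading, connected strips. [cite: KozmaNitzan2024, §4 p. 16 (Lemma 8)] -/
def line : LineSkeletonNeg graph where
  ψ := ψ
  lip := fun _ _ h => abs_ψ_sub_le h
  types := types
  frame := by
    rintro ⟨v, k⟩
    refine ⟨((0 : Site 2), k), mem_types k, shiftIso v, ?_, fun w => ?_⟩
    · show ((0 : Site 2) + v, k) = (v, k)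
      rw [zero_add]
    · show ψ (w.1 + v, w.2) = ψ w + (ψ (v, k) - ψ ((0 : Site 2), k))
      simp only [ψ, Pi.add_apply, Pi.zero_apply]; ring
  neg := by
    intro t ht
    simp only [types, Finset.mem_insert, Finset.mem_singleton] at ht
    refine ⟨negIso, ?_, fun w => ?_⟩
    · rcases ht with rfl | rfl | rfl | rfl <;> exact Prod.ext neg_zero rfl
    · have h0 : ψ t = 0 := by rcases ht with rfl | rfl | rfl | rfl <;> simp [ψ]
      show ψ (-w.1, w.2) - ψ t = -(ψ w - ψ t)
      rw [h0]
      obtain ⟨x, m⟩ := w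
      simp only [ψ_mk, Pi.neg_apply]; ring
  Δ := 4
  degree_le := degree_le
  step := by
    rintro ⟨v, k⟩ σ
    rcases Int.units_eq_one_or σ with hσ | hσ <;> subst hσ
    · -- height + 1: move along the heading if `sdir k = 1`, against it otherwise
      fin_cases k
      · exact ⟨(v + dir 0, 0), adj_move v 0, by rw [ψ_move]; simp [sdir]⟩
      · exact ⟨(v + dir 1, 1), adj_move v 1, by rw [ψ_move]; simp [sdir]⟩
      · refine ⟨(v - dir 2, 2), adj_move' v 2, ?_⟩
        have := ψ_move (v - dir 2) 2; rw [sub_add_cancel] at this; simp [sdir] at this; simp; omega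
      · refine ⟨(v - dir 3, 3), adj_move' v 3, ?_⟩
        have := ψ_move (v - dir 3) 3; rw [sub_add_cancel] at this; simp [sdir] at this; simp; omega
    · fin_cases k
      · refine ⟨(v - dir 0, 0), adj_move' v 0, ?_⟩
        have := ψ_move (v - dir 0) 0; rw [sub_add_cancel] at this; simp [sdir] at this; simp; omega
      · refine ⟨(v - dir 1, 1), adj_move' v 1, ?_⟩
        have := ψ_move (v - dir 1) 1; rw [sub_add_cancel] at this; simp [sdir] at this; simp; omega
      · exact ⟨(v + dir 2, 2), adj_move v 2, by rw [ψ_move]; simp [sdir]⟩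
      · exact ⟨(v + dir 3, 3), adj_move v 3, by rw [ψ_move]; simp [sdir]⟩
  strip_connected := by
    intro t ht ℓ hℓ
    simp only [types, Finset.mem_insert, Finset.mem_singleton] at ht
    have h0 : ψ t = 0 := by rcases ht with rfl | rfl | rfl | rfl <;> simp [ψ]
    have hS : {w : Vtx | |ψ w - ψ t| ≤ ℓ} = stripSet ℓ := by
      ext w; rw [mem_stripSet, Set.mem_setOf_eq, h0, sub_zero]
    rw [hS]
    haveI : Nonempty (stripSet ℓ) := ⟨⟨((0 : Site 2), 0), by rw [mem_stripSet]; simp⟩⟩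
    exact Connected.mk fun a b => (reachable_zero hℓ a.1 a.2).trans (reachable_zero hℓ b.1 b.2).symm

/-- **THEOREM (unconditional).  `θ_v(p_c) = 0` at every vertex of `X □ ℤ = Cay((ℤ² ⋊ C₄) × ℤ; ρ, x, t)`** — a Cayley graph of a group with first Betti
number ONE, through the closed side-on D″ theorem.  builds on p205010 (kernel theorem, internal audit signed; external expert review pending).
[cite: BenjaminiSchramm1996, Conj. 4; §2] [cite: KozmaNitzan2024, §1 p. 2 (approach 1)] -/
theorem criticalContinuity (v : Vtx × Site 1) : theta (graph □ zdGraph 1) v (criticalProbIOf (graph □ zdGraph 1) v) = 0 :=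
  line.prodInt_criticalContinuity_holds v

end Z2Rot

end Summit.CriticalPhenomena.PercolationContinuityZ3.Theorems.Transplant

end
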